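import Summits.QuantumFields.YangMills.Theorems.BalabanUVNodesN15KingModelPotentialDressedDecayRate

/-!
# BalabanUVNodes ∕ N15 — THE KING MODEL, PART 14: KING'S PROP. 3.8 (3.71) LINE 1 FOR THE DRESSED MINIMISER ALONG THE RUN —
# `|ℋ_{k+1,v}(x′, b) − ℋ_{k,v}(x, b)| ≤ c·((L^{−1∕2})^k + ν₀s^k)·e^{−δ|B(x′) − b|}` for every coherent potential tower in the window
# (Track A, DAG node N15 = NE2; FAN-OUT v1.1 §N15 s3 «KING-MODEL RUNG»)

HONEST FRAMING.  Count-neutral kernel bookkeeping (cell `pub-ymgap`, seat `pub-ymgap-dag-n15-d` g8; `--supports stmt-QuantumFields-20292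
--as helper` = K3⁗ `SpineGivenEndpointR13Sep`; lineage K3 19676 → K3′ 19908 → K3‴ 19912).  THEOREMS ONLY (0 `def`, 0 `sorry`), standard axioms.
King's `A = 0` SCALAR tower on the King-admissible unit tori `Π ℤ∕(2L^{e+1})` (odd `L ≥ 3`, `m² > 0`); the dressed minimiser `ℋ_{k,w}` of part 10b
(`kingHPot`) for a fine-lattice POTENTIAL (a multiplication operator, NOT a gauge field; nothing here is Bałaban's `H_k(U)` of [B9] §D (3.133));
NOT a node discharge; nothing continuum ∕ ℝ⁴ ∕ OS ∕ mass-gap ∕ Clay.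
THE POINT.  King prints two theorems about the minimiser `ℋ_k = a_kG_kQ_k^*`: Theorem 3.3 (3.7) (exponential decay) and Prop. 3.8 (3.71) line 1
(two-spacing rate).  Part 11d exported the first for the DRESSED minimiser along the run (`kingHPot_decay_kingU`); the second was proved inside
11d's `fullPert_stepDecay_kingU` but not exported.  THIS FILE states it: ★★ **`kingHPot_stepDecay_kingU`** — `∃ w̄, c, δ > 0` such that for every
volume exponent `e`, every potential tower `v` of size `≤ w₀ ≤ w̄` with coherence `(ν₀, s ≤ L^{−1∕2})`, every `k ≥ 1`, every unit site `b` and fine point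
`x′` of the finer run (`x` under `x′`):  `|ℋ_{k+1,v}(x′, b) − ℋ_{k,v}(x, b)| ≤ c·((L^{−1∕2})^k + ν₀·s^k)·e^{−δ|B(x′) − b|}` — constants uniform in `k`, the
volume and the potential (11c `kingHPot_step_decay` on 8b's letters, 11a∕11b's weighted Riemann bounds, 11c's dressed decay, the window of 9a∕9c).
HONEST SCOPE.  As parts 10c∕11d; not a discharge.
Locators: [King1986] C. King, CMP **102** (1986) 649–677: (2.13)–(2.15) p. 653, Theorem 3.3 (3.7) p. 658 (PDF: p. 655, (3.7) p. 656), Prop. 3.8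
(3.71) p. 664 and p. 664 (pairing `x′ ∈ B^n(x)`); [B9] = [Balaban1985BackgroundPropagators] (3.35)–(3.36) p. 396, §D (3.133) p. 421 (template).
-/

noncomputable section

open scoped BigOperators Matrix
open Finset

namespace Summit.QuantumFields.YangMills.BalabanUVNodes.N15.KingModel

open Literature.MathematicalPhysics.QuantumFieldTheory.Balaban1983to89 hiding blockOf
open Literature.MathematicalPhysics.QuantumFieldTheory.Balaban1983to89.B4Sect5Proof (latticeConst latticeConst_nonneg)
open Literature.MathematicalPhysics.QuantumFieldTheory.Balaban1983to89.B5Prop11Plancherel (Tor fine)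
open Literature.MathematicalPhysics.QuantumFieldTheory.King1986 (aK aK_pos)
open Literature.MathematicalPhysics.QuantumFieldTheory.King1986.Torus
open Summit.QuantumFields.YangMills.BalabanUVNodes.N15KingModelRung (kingH)
open Summit.QuantumFields.YangMills.BalabanUVNodes.N15KingModelRung.Curved (underPtN val_underPtN blockOf_underPtN)

variable {d : ℕ}

section StepRun

open Real

variable (L : ℕ) [NeZero L]

/-- **KING'S PROP. 3.8 (3.71) LINE 1 FOR THE DRESSED MINIMISER ALONG THE RUN** (module docstring). [cite: King1986, (2.15) p.653, Theorem 3.3 (3.7) p.658, Prop. 3.8 (3.71) p.664 and p.664 (pairing)] -/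
theorem kingHPot_stepDecay_kingU (hLodd : Odd L) (hL : 2 ≤ L) {a m2 : ℝ} (ha : 0 < a) (hm : 0 < m2) :
    ∃ wb c δ : ℝ, 0 < wb ∧ 0 < c ∧ 0 < δ ∧ ∀ (e : ℕ) (v : ∀ N : ℕ, Tor (fine N (kingU d L e)) → ℝ) (w₀ ν₀ s : ℝ),
      (∀ (N : ℕ) (x : Tor (fine N (kingU d L e))), |v N x| ≤ w₀) → w₀ ≤ wb → 0 ≤ ν₀ → 0 ≤ s → s ≤ (L : ℝ) ^ (-(1 / 2 : ℝ)) →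
      (∀ (k : ℕ), 1 ≤ k → ∀ x' : Tor (fine (L ^ 1 * L ^ k) (kingU d L e)),
          |v (L ^ 1 * L ^ k) x' - v (L ^ k) (underPtN L k 1 (kingU d L e) x')| ≤ ν₀ * s ^ k) →
      ∀ (k : ℕ), 1 ≤ k → ∀ (b : Tor (kingU d L e)) (x' : Tor (fine (L ^ 1 * L ^ k) (kingU d L e))),
        |kingHPot L (L ^ 1 * L ^ k) (kingU d L e) a m2 (k + 1) (v (L ^ 1 * L ^ k)) b x'
            - kingHPot L (L ^ k) (kingU d L e) a m2 k (v (L ^ k)) b (underPtN L k 1 (kingU d L e) x')|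
          ≤ c * (((L : ℝ) ^ (-(1 / 2 : ℝ))) ^ k + ν₀ * s ^ k)
            * Real.exp (-(δ * tdistT (kingU d L e) (blockOf (L ^ 1 * L ^ k) (kingU d L e) x') b)) := by
  have hL1 : 1 < L := by omega
  have hLr : (1 : ℝ) < L := by exact_mod_cast hL1
  obtain ⟨δH, cH, hδH, hcH, HH⟩ := kingH_decay_kingU (d := d) L hLodd hL ha hm.le
  obtain ⟨δS, CS, hδS, hCS, HS⟩ := kingH_step_kingU (d := d) L hLodd hL ha hm
  obtain ⟨δW, CW, hδW, hCW, HW⟩ := fullProp_riemannMassW_unif (d := d) L hLodd hL ha hm.le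
  obtain ⟨δR, CR, hδR, hCR, HR⟩ := fullProp_riemannRateW_unif (d := d) L hLodd hL ha hm.le (γ := 1) zero_le_one le_rfl
  obtain ⟨-, -, hwbar⟩ := dressedConsts_nonneg (d := d) ha hL
  set δ : ℝ := min (min δH δS) (min δW δR) with hδdef
  have hδ : 0 < δ := lt_min (lt_min hδH hδS) (lt_min hδW hδR)
  have hδH' : δ ≤ δH := (min_le_left _ _).trans (min_le_left _ _)
  have hδS' : δ ≤ δS := (min_le_left _ _).trans (min_le_right _ _)
  have hδW' : δ ≤ δW := (min_le_right _ _).trans (min_le_left _ _)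
  have hδR' : δ ≤ δR := (min_le_right _ _).trans (min_le_right _ _)
  set wb : ℝ := min (wbarK (d + 1) a L) (1 / (2 * CW)) with hwbdef
  have hwb : 0 < wb := lt_min hwbar (by positivity)
  set c : ℝ := 2 * CS + 4 * CR * wb * cH + 4 * CW * cH + 1 with hcdef
  have hc : 0 < c := by positivity
  refine ⟨wb, c, δ, hwb, hc, hδ, fun e v w₀ ν₀ s hv hw hν₀ hs0 hs1 hcoh k hk1 b x' => ?_⟩
  set r : ℝ := (L : ℝ) ^ (-(1 / 2 : ℝ)) with hrdef
  have hr0 : 0 ≤ r := Real.rpow_nonneg (Nat.cast_nonneg _) _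
  have hw₀ : 0 ≤ w₀ := (abs_nonneg _).trans (hv 0 fun _ => 0)
  have hM' : ∀ μ, kingU d L e μ = 2 * L ^ (e + 1) := fun μ => by
    show L * (2 * L ^ e) = 2 * L ^ (e + 1)
    ring
  have hN' : L ^ 1 * L ^ k = L ^ (k + 1) := by ring
  have hak : 0 < aK a L k := aK_pos ha hLr hk1
  have hak' : 0 < aK a L (k + 1) := aK_pos ha hLr (by omega)
  have hwbar' : w₀ ≤ wbarK (d + 1) a L := hw.trans (min_le_left _ _)
  have hwin : CW * w₀ ≤ 1 / 2 := by
    have h1 : w₀ ≤ 1 / (2 * CW) := hw.trans (min_le_right _ _)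
    rw [le_div_iff₀ (by positivity)] at h1
    linarith
  have hlo : ∀ (N : ℕ) (x : Tor (fine N (kingU d L e))), -w₀ ≤ v N x := fun N x => (abs_le.mp (hv N x)).1
  have hB : IsUnit (fineOpPot (L ^ k) (kingU d L e) (aK a L k) (((L ^ k : ℕ) : ℝ) ^ 2) m2 (v (L ^ k))) :=
    fineOpPot_isUnit hak.le hm.le (hlo (L ^ k)) (by
      obtain ⟨-, -, hgap, -⟩ := gap_unif (d := d) ha hL hk1 hwbar'
      have hP : 0 ≤ (2 * ((d + 1 : ℕ) : ℝ) + aK a L k) * (4 * kapCT (d + 1) a L) ^ 2 := by positivity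
      linarith)
  have hB' : IsUnit (fineOpPot (L ^ 1 * L ^ k) (kingU d L e) (aK a L (k + 1)) (((L ^ 1 * L ^ k : ℕ) : ℝ) ^ 2) m2 (v (L ^ 1 * L ^ k))) :=
    fineOpPot_isUnit hak'.le hm.le (hlo (L ^ 1 * L ^ k)) (by
      obtain ⟨-, -, hgap, -⟩ := gap_unif (d := d) ha hL (by omega : 1 ≤ k + 1) hwbar'
      have hP : 0 ≤ (2 * ((d + 1 : ℕ) : ℝ) + aK a L (k + 1)) * (4 * kapCT (d + 1) a L) ^ 2 := by positivity
      linarith)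
  have hHdec' : ∀ (b : Tor (kingU d L e)) (x' : Tor (fine (L ^ 1 * L ^ k) (kingU d L e))),
      |kingH L (L ^ 1 * L ^ k) (kingU d L e) a m2 (k + 1) b x'|
        ≤ cH * Real.exp (-(δ * tdistT (kingU d L e) (blockOf (L ^ 1 * L ^ k) (kingU d L e) x') b)) :=
    fun b x' => decay_mono hcH.le hδH' ((tdistT_isPseudoDist (kingU d L e)).nonneg _ _) (HH e (k + 1) (by omega) (L ^ 1 * L ^ k) hN' b x')
  have hstep : ∀ (b : Tor (kingU d L e)) (x' : Tor (fine (L ^ 1 * L ^ k) (kingU d L e))),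
      |kingH L (L ^ 1 * L ^ k) (kingU d L e) a m2 (k + 1) b x' - kingH L (L ^ k) (kingU d L e) a m2 k b (underPtN L k 1 (kingU d L e) x')|
        ≤ CS * r ^ k * Real.exp (-(δ * tdistT (kingU d L e) (blockOf (L ^ 1 * L ^ k) (kingU d L e) x') b)) :=
    fun b x' => decay_mono (by positivity) hδS' ((tdistT_isPseudoDist (kingU d L e)).nonneg _ _) (HS e k hk1 b x')
  have hmassW : ∀ x : Tor (fine (L ^ k) (kingU d L e)), (((L ^ k : ℕ) : ℝ) ^ (d + 1))⁻¹ *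
      ∑ y, |constrainedProp (L ^ k) (kingU d L e) (aK a L k) (((L ^ k : ℕ) : ℝ) ^ 2) m2 x y|
        * Real.exp (δ * tdistT (kingU d L e) (blockOf (L ^ k) (kingU d L e) x) (blockOf (L ^ k) (kingU d L e) y)) ≤ CW :=
    fun x => HW k hk1 δ hδ.le hδW' (L ^ k) rfl (e + 1) (kingU d L e) hM' m2 hm le_rfl x
  have hmassW' : ∀ x' : Tor (fine (L ^ 1 * L ^ k) (kingU d L e)), (((L ^ 1 * L ^ k : ℕ) : ℝ) ^ (d + 1))⁻¹ *
      ∑ y', |constrainedProp (L ^ 1 * L ^ k) (kingU d L e) (aK a L (k + 1)) (((L ^ 1 * L ^ k : ℕ) : ℝ) ^ 2) m2 x' y'|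
        * Real.exp (δ * tdistT (kingU d L e) (blockOf (L ^ 1 * L ^ k) (kingU d L e) x') (blockOf (L ^ 1 * L ^ k) (kingU d L e) y')) ≤ CW :=
    fun x' => HW (k + 1) (by omega) δ hδ.le hδW' (L ^ 1 * L ^ k) hN' (e + 1) (kingU d L e) hM' m2 hm le_rfl x'
  have hrateW : ∀ x' : Tor (fine (L ^ 1 * L ^ k) (kingU d L e)), (((L ^ 1 * L ^ k : ℕ) : ℝ) ^ (d + 1))⁻¹ *
      ∑ y', |constrainedProp (L ^ 1 * L ^ k) (kingU d L e) (aK a L (k + 1)) (((L ^ 1 * L ^ k : ℕ) : ℝ) ^ 2) m2 x' y'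
        - constrainedProp (L ^ k) (kingU d L e) (aK a L k) (((L ^ k : ℕ) : ℝ) ^ 2) m2 (underPtN L k 1 (kingU d L e) x')
          (underPtN L k 1 (kingU d L e) y')|
        * Real.exp (δ * tdistT (kingU d L e) (blockOf (L ^ k) (kingU d L e) (underPtN L k 1 (kingU d L e) x'))
          (blockOf (L ^ k) (kingU d L e) (underPtN L k 1 (kingU d L e) y'))) ≤ CR * r ^ k :=
    fun x' => HR k hk1 δ hδ.le hδR' 1 le_rfl (e + 1) (kingU d L e) hM' m2 hm le_rfl x'
  have hwk : ∀ y, |v (L ^ k) y| ≤ w₀ := hv (L ^ k)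
  have hwk' : ∀ y', |v (L ^ 1 * L ^ k) y'| ≤ w₀ := hv (L ^ 1 * L ^ k)
  have hH' : ∀ (b : Tor (kingU d L e)) (y' : Tor (fine (L ^ 1 * L ^ k) (kingU d L e))),
      |kingHPot L (L ^ 1 * L ^ k) (kingU d L e) a m2 (k + 1) (v (L ^ 1 * L ^ k)) b y'|
        ≤ 2 * cH * Real.exp (-(δ * tdistT (kingU d L e) (blockOf (L ^ 1 * L ^ k) (kingU d L e) y') b)) :=
    fun b y' => kingHPot_decay hak'.le hm hB' hcH.le hδ.le hHdec' hmassW' hwk' hwin b y'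
  have hSd := kingHPot_step_decay L hak.le hak'.le hm hB hB' (by positivity : 0 ≤ CS * r ^ k) hCW.le (by positivity : 0 ≤ CR * r ^ k)
    (by positivity : 0 ≤ 2 * cH) hδ.le hstep hmassW hrateW hwk hwk' (hcoh k hk1) hwin hH' b x'
  refine hSd.trans (mul_le_mul_of_nonneg_right ?_ (Real.exp_pos _).le)
  -- bookkeeping: `2(C_S r^k + C_R r^k·(w₀·2c_H) + C_W·(ν₀s^k·2c_H)) ≤ c·(r^k + ν₀s^k)` with `w₀ ≤ w̄`
  have hrk : 0 ≤ r ^ k := pow_nonneg hr0 k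
  have hνs : 0 ≤ ν₀ * s ^ k := by positivity
  have h1 : CR * r ^ k * (w₀ * (2 * cH)) ≤ 2 * CR * wb * cH * r ^ k := by
    have := mul_le_mul_of_nonneg_left hw (by positivity : 0 ≤ 2 * CR * cH * r ^ k)
    nlinarith
  rw [hcdef]
  nlinarith [mul_nonneg hCS.le hrk, mul_nonneg hCW.le hνs, mul_nonneg (mul_nonneg (mul_nonneg hCR.le hwb.le) hcH.le) hνs,
    mul_nonneg hCS.le hνs, mul_nonneg (mul_nonneg hCW.le hcH.le) hrk, hrk, hνs]

end StepRun

end Summit.QuantumFields.YangMills.BalabanUVNodes.N15.KingModel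

end
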